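import Mathlib
import HarnessLib
import Literature.NumberTheory.Irrationality.Zudilin2014.FirstTaleArithmetic
import Summits.KontsevichZagierPeriods.Zeta5Search.Denom.TwoTaleP15Forms
import Summits.KontsevichZagierPeriods.Zeta5Search.Denom.TwoTaleR3Saving

/-!
# Rung A — the forms and the conditional measure at (α | β) = (6,5,4,7 | 0,1,2,12)

HONEST FRAMING: systematic search; no irrationality claim unless certified.  This file claims NO measure of `ζ(2)`.
It instantiates the tree's GENERAL first-tale objects of Zudilin 2014 (`Zudilin2014.formQZ`, `Zudilin2014.formP`,
P1 g9's `FirstTale`/`FirstTaleArithmetic`) at fam-measure's rung-A point `a = (6n+1, 5n+1, 4n+1, 7n+1)`,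
`b = (1, n+1, 2n+1, 12n+2)` (the multiset of [Zudilin2014ZetaTwo, Remark 3]; `d = 7n − 1`, normaliser `D₇ₙ²`), names
the three inputs of Hata's lemma as `@[conjecture]` Props (NOT proved here):
* `InclusionA` — `Φₙ ∣ D₇ₙ² qₙ` and `Φₙ⁻¹ D₇ₙ² pₙ ∈ ℤ` with `Φₙ = TwoTaleR3Saving.savingProductA n` (Zudilin's Lemma 7 at the
  point: FIRST TALE ONLY, no missing brick — P1 g9's general Lemma 7 once landed);
* `DecayA c` — `|qₙ ζ(2) − pₙ| ≤ e^{−cn}` eventually (model `C₀ = 13.22912875…`, fam-measure §10.5; elementary by the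
  vertical-line bound, cf. `TwoTaleP15Decay`);
* `CoeffRateA C₁` — `(1/n) log|qₙ| → C₁` (model `C₁ = 18.75527331…`; Whipple + one-signed second tale, fam-measure §10.3);
and PROVES the implication `exponentLE_of_inputsA : InclusionA → DecayA c → CoeffRateA C₁ → 14 − S < c → 0 < C₁ →
ExponentLE (ζ(2)) (1 + (C₁ + 14 − S)/(c − 14 + S))` (`S = savingRateA`, certified `6.91559 ≤ S ≤ 6.9157`) with the numeric
corollaries `… → ExponentLE (ζ(2)) 5.2054` (`c = 13.229`, `C₁ ≤ 18.7553`) and the loose `… → ExponentLE (ζ(2)) 5.233`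
(`c = 13.2`, `C₁ ≤ 18.8`).  The printed value at this point is `5.20514736…` [Zudilin2014ZetaTwo, Remark 3] — not a record
(Zudilin's is `5.09541178`); rung A matters because all three inputs are elementary here (families/measure/FAMILY.md §10.5).
-/

noncomputable section

open Filter Topology Finset
open Literature.NumberTheory.Transcendental
open Literature.NumberTheory.Irrationality
open Summit.KontsevichZagierPeriods.Zeta5Search
open Summit.KontsevichZagierPeriods.Zeta5Search.Denom.TwoTaleP15Forms
open Summit.KontsevichZagierPeriods.Zeta5Search.Denom.TwoTaleR3Saving

namespace Summit.KontsevichZagierPeriods.Zeta5Search.Denom.TwoTaleR3Forms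

/-! ### The point -/

/-- The slopes `(6, 5, 4, 7)` of `a_j = α_j n + 1`. -/
def slopeRungA : Fin 4 → ℕ := ![6, 5, 4, 7]

/-- `a = (6n+1, 5n+1, 4n+1, 7n+1)`. -/
def aRungA (n : ℕ) : Fin 4 → ℤ := fun i => (slopeRungA i : ℤ) * n + 1

/-- `b = (1, n+1, 2n+1, 12n+2)`. -/
def bRungA (n : ℕ) : Fin 4 → ℤ := ![1, (n : ℤ) + 1, 2 * (n : ℤ) + 1, 12 * (n : ℤ) + 2]

/-- `aRungA_zero` (simp lemma). -/
@[simp] theorem aRungA_zero (n : ℕ) : aRungA n 0 = 6 * n + 1 := by simp [aRungA, slopeRungA]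
/-- `aRungA_one` (simp lemma). -/
@[simp] theorem aRungA_one (n : ℕ) : aRungA n 1 = 5 * n + 1 := by simp [aRungA, slopeRungA]
/-- `aRungA_two` (simp lemma). -/
@[simp] theorem aRungA_two (n : ℕ) : aRungA n 2 = 4 * n + 1 := by simp [aRungA, slopeRungA]
/-- `aRungA_three` (simp lemma). -/
@[simp] theorem aRungA_three (n : ℕ) : aRungA n 3 = 7 * n + 1 := by simp [aRungA, slopeRungA]
/-- `bRungA_zero` (simp lemma). -/
@[simp] theorem bRungA_zero (n : ℕ) : bRungA n 0 = 1 := rfl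
/-- `bRungA_one` (simp lemma). -/
@[simp] theorem bRungA_one (n : ℕ) : bRungA n 1 = (n : ℤ) + 1 := rfl
/-- `bRungA_two` (simp lemma). -/
@[simp] theorem bRungA_two (n : ℕ) : bRungA n 2 = 2 * (n : ℤ) + 1 := rfl
/-- `bRungA_three` (simp lemma). -/
@[simp] theorem bRungA_three (n : ℕ) : bRungA n 3 = 12 * (n : ℤ) + 2 := rfl

/-- The point is admissible for `n ≥ 1` (eq. (cond1): `b_j ≤ a_i < b₄`; `d = 7n − 1 ≥ 0` needs `n ≥ 1`). -/
theorem admissibleA {n : ℕ} (hn : 1 ≤ n) : Zudilin2014.Admissible (aRungA n) (bRungA n) where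
  lower j hj i := by
    have hi : (4 : ℤ) * n + 1 ≤ aRungA n i := by fin_cases i <;> simp <;> omega
    fin_cases j <;> simp at hj ⊢ <;> linarith
  upper i := by
    have hi : aRungA n i ≤ 7 * (n : ℤ) + 1 := by fin_cases i <;> simp <;> omega
    simp only [bRungA_three]; linarith
  balance := by
    simp only [Fin.sum_univ_four, bRungA_zero, bRungA_one, bRungA_two, bRungA_three, aRungA_zero, aRungA_one, aRungA_two, aRungA_three]
    omega

/-! ### The forms (instances of the general first tale) -/

/-- **`qₙ ∈ ℤ`** at rung A: `Zudilin2014.formQZ (aRungA n) (bRungA n)`. -/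
def formQA (n : ℕ) : ℤ := Zudilin2014.formQZ (aRungA n) (bRungA n)

/-- **`pₙ ∈ ℚ`** at rung A: `Zudilin2014.formP (aRungA n) (bRungA n)`. -/
def formPA (n : ℕ) : ℚ := Zudilin2014.formP (aRungA n) (bRungA n)

/-- `qₙ` is the rational form `q(a,b)` of Prop. 1 (`FirstTaleArithmetic.formQ_eq_cast`). -/
theorem formQA_cast {n : ℕ} (hn : 1 ≤ n) : (formQA n : ℚ) = Zudilin2014.formQ (aRungA n) (bRungA n) :=
  (Zudilin2014.formQ_eq_cast (admissibleA hn)).symm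

/-- The normaliser `D₇ₙ · D₇ₙ` (Prop. 1 at the point: `c₁ = c₂ = 7n`). -/
def lcmNormaliserA (n : ℕ) : ℕ := Nat.lcmUpto (7 * n) * Nat.lcmUpto (7 * n)

/-- `D₇ₙ² > 0`. -/
theorem lcmNormaliserA_pos (n : ℕ) : 0 < lcmNormaliserA n :=
  Nat.mul_pos (Nat.lcmUpto_pos _) (Nat.lcmUpto_pos _)

/-! ### The three inputs (named, NOT proved here) -/

/-- **INPUT A1 — inclusion** (Zudilin's Lemma 7 at the point, first tale only): `Φₙ ∣ D₇ₙ² qₙ` and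
`Φₙ⁻¹ D₇ₙ² pₙ ∈ ℤ`, `Φₙ = savingProductA n`. Not a tree theorem. -/
@[conjecture] def InclusionA : Prop :=
  ∀ n : ℕ, 1 ≤ n →
    (∃ B : ℤ, ((lcmNormaliserA n : ℕ) : ℤ) * formQA n = (savingProductA n : ℤ) * B) ∧
      ∃ A : ℤ, ((lcmNormaliserA n : ℕ) : ℚ) * formPA n = (savingProductA n : ℚ) * A

/-- **INPUT A2 — decay** with constant `c`: `|qₙ ζ(2) − pₙ| ≤ e^{−cn}` eventually (model `C₀ = 13.22912875…`). -/
@[conjecture] def DecayA (c : ℝ) : Prop :=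
  ∀ᶠ n : ℕ in atTop, |(formQA n : ℝ) * zetaValue 2 - (formPA n : ℝ)| ≤ Real.exp (-(c * n))

/-- **INPUT A3 — coefficient rate** `C₁`: `(1/n) log|qₙ| → C₁` (model `C₁ = 18.75527331…`). -/
@[conjecture] def CoeffRateA (C₁ : ℝ) : Prop :=
  Tendsto (fun n : ℕ => Real.log |(formQA n : ℝ)| / n) atTop (𝓝 C₁)

/-! ### The conditional measure (PROVED implication) -/

/-- The normaliser rate: `(1/n) log (D₇ₙ²/Φₙ) → 14 − S` (`TwoTaleR3Saving.tendsto_log_lcmNormaliserA_div`). -/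
theorem tendsto_log_lcmNormaliserA_div_savingProductA :
    Tendsto (fun n : ℕ => Real.log ((lcmNormaliserA n : ℝ) / savingProductA n) / n) atTop
      (𝓝 (14 - savingRateA)) := by
  refine tendsto_log_lcmNormaliserA_div.congr fun n => ?_
  simp only [lcmNormaliserA, Nat.cast_mul]

/-- **The measure at rung A from the three inputs (PROVED implication)**, `S = savingRateA`:
`μ(ζ(2)) ≤ 1 + (C₁ + (14 − S))/(c − (14 − S))` in the `ExponentLE` sense. -/
theorem exponentLE_of_inputsA {c C₁ : ℝ} (hI : InclusionA) (hD : DecayA c) (hC : CoeffRateA C₁)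
    (hc : 14 - savingRateA < c) (hC₀ : 0 < C₁) :
    ExponentLE (zetaValue 2) (1 + (C₁ + (14 - savingRateA)) / (c - (14 - savingRateA))) := by
  choose! B hB using fun n (hn : 1 ≤ n) => (hI n hn).1
  choose! A hA using fun n (hn : 1 ≤ n) => (hI n hn).2
  have hS := savingRateA_lt
  exact exponentLE_of_normalisedForms irrational_zetaValue_two lcmNormaliserA_pos savingProductA_pos hB hA hD hC
    tendsto_log_lcmNormaliserA_div_savingProductA hc hC₀ (by linarith)

/-- **Rung A, numerically (PROVED implication; inputs NOT certified):** `c = 13.229 < C₀`, `0 < C₁ ≤ 18.7553` and the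
certified `S ≥ 6.91559` give `μ(ζ(2)) ≤ 5.2054` (printed model value `5.20514736…`, [Zudilin2014ZetaTwo, Remark 3]). -/
theorem zetaTwo_exponent_le_of_inputsA {C₁ : ℝ} (hI : InclusionA) (hD : DecayA 13.229) (hC : CoeffRateA C₁)
    (hC₀ : 0 < C₁) (hC₁ : C₁ ≤ 18.7553) : ExponentLE (zetaValue 2) 5.2054 := by
  have hS := savingRateA_bounds
  have h := exponentLE_of_inputsA hI hD hC (by linarith [hS.1]) hC₀
  have hden : 0 < 13.229 - (14 - savingRateA) := by linarith [hS.1]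
  have hle : 1 + (C₁ + (14 - savingRateA)) / (13.229 - (14 - savingRateA)) ≤ 5.2054 := by
    have h1 : (C₁ + (14 - savingRateA)) / (13.229 - (14 - savingRateA)) ≤ 4.2054 := by
      rw [div_le_iff₀ hden]
      linarith [hS.1]
    linarith
  exact h.mono hle

/-- **Loose-constant variant** (margins for certified numerics): `c = 13.2`, `0 < C₁ ≤ 18.8` give `μ(ζ(2)) ≤ 5.233`. -/
theorem zetaTwo_exponent_le_looseA {C₁ : ℝ} (hI : InclusionA) (hD : DecayA 13.2) (hC : CoeffRateA C₁)
    (hC₀ : 0 < C₁) (hC₁ : C₁ ≤ 18.8) : ExponentLE (zetaValue 2) 5.233 := by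
  have hS := savingRateA_bounds
  have h := exponentLE_of_inputsA hI hD hC (by linarith [hS.1]) hC₀
  have hden : 0 < 13.2 - (14 - savingRateA) := by linarith [hS.1]
  have hle : 1 + (C₁ + (14 - savingRateA)) / (13.2 - (14 - savingRateA)) ≤ 5.233 := by
    have h1 : (C₁ + (14 - savingRateA)) / (13.2 - (14 - savingRateA)) ≤ 4.233 := by
      rw [div_le_iff₀ hden]
      linarith [hS.1]
    linarith
  exact h.mono hle

end Summit.KontsevichZagierPeriods.Zeta5Search.Denom.TwoTaleR3Forms

end
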